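import Summits.QuantumFields.BalabanUV.Beta.GAN24.Push3
import Summits.QuantumFields.BalabanUV.Beta.GAN24.Push4TwoRate

/-!
# `BalabanUV.Beta.GAN24.LayerPushEntry` — binder row G-an2-4 / (CONV-C), W-slot CT-W, route «WC-TL» ∕ «QR-LL» (the OWNER gan24-p1 g25's `gen25/QR-DESIGN-v0.md` §3,
# RULING preview R-gan24p1-g25-1), row **(LT) «LAYER TRANSPORT», part 1 — THE WEIGHTED ENTRY ESTIMATE OF THE THREE-LEG PUSH** (this lineage's first refusal, W5 ∕ W13
# l.39336 ∕ l.39455; statement proposal `LT-STATEMENT-v0.md` §2, journal l.39483)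

NOT IN PRINT; OUR BOOKKEEPING ([folklore] real analysis on `ℤ^{d+1}` over leaf-01 g43's `Push3.push₃` ∕ `push₃_inl_inl` and leaf-03's two-rate bricks
`Push4TwoRate.abs_tsum_leg_le` ∕ `summable_leg`; G-an2-4 formalisation swarm, leaf prover `b2b-balaban-gan24-formalise-leaf-01`, gen 63).  HONEST FRAMING (cell contract,
verbatim): «discharging `BetaPertH` makes Bałaban's UV stability UNCONDITIONAL — a real constructive-QFT result; it is NOT the continuum limit and NOT the Clay problem.»
HONEST DEPENDENCY (verbatim): «continuum YM on T⁴ ⇐ BetaPertH ∧ nine spine estimates (0/9 proved); BetaPertH ⇐ (D1) ∧ (D4) ∧ CAP+tail; G-an2-4 gates asym, D1 and NE2/3/4.»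

## What (generic `d`, any relative blocking `N ≥ 1`, GENERIC legs, GENERIC weight — no object of an2's typed system occurs)
The three-leg push `push₃ l r w S ν U` of a stencil family `S` whose slot profile carries a WEIGHT `ω` — `|S κ u x z a b| ≤ Cs·ω u·e^{−m(‖x−u‖₁+‖z−u‖₁)}`,
`0 ≤ ω ≤ Ω` (the OWNER's `LayerStencil` envelope and leaf-03's face weight `ω_B` are instances) — through legs given by COARSE envelopes (the shapes of the composite dressed ∕
undressed response families: kernel legs `|l α x′ κ x| ≤ Cl·e^{−κ‖quo N x − x′‖₁}`, table leg `|w ν U κ u| ≤ Cw·e^{−κ‖quo N u − U‖₁}`, the FLATNESS of the table leg being part of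
`Cw`) obeys, entry by entry,
**`|push₃ l r w S ν U x′ z′ (inl α) (inl β)| ≤ (d+1)³·Cl·Cr·Cw·Cs·Zl_{d+1}(m∕2)² · e^{−τ(‖x′−U‖₁+‖z′−U‖₁)} · Σ'_u ω u·e^{−(κ∕2)‖quo N u − U‖₁}`**, `τ = min (κ∕4) (min κ (m∕2))`
(`abs_push₃_inl_inl_le_weighted`; the other blocks vanish, `Push3.push₃_inr_left ∕ _right`).  The bracket — the WEIGHTED BLOCK COUNT — is the ONLY place the blocking enters: for
`ω ≡ 1` it is `N^{d+1}·Zl` (leaf-03's `tsum_block_four_le` mechanism: the marginal row), for a boundary-LAYER weight it is `O(t·N^d)` (part 2, `LayerCount`) — against a flat table leg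
`Cw = K·N^{−(d+1)}` this is a `t·N^{−1}` GAIN RELATIVE TO THE MARGINAL ROW only — in row V's
absolute currency a BARE layer letter nets `t·L^{d−3}` (= `t·L^0` at `d = 3`: K-LL-3 FIRES for bare letters; power count R-leaf01-g63-2 l.39848, RULING R-gan24p1-g25-2
l.39869), so this file is the BRICK (mechanism (b)) the (LT-Δ) END imports for its interior ∕ tail bookkeeping — NOT the END itself, which carries ONE explicit difference moved
onto a response leg.  Steps: §1 the vertex `vertexW w S` against the weight; §2 the `x`-sum by `abs_tsum_leg_le` (leg SUP + block label,
paid by the letter's fine decay); §3 the `z`-sum likewise and the three-factor split of the slot profile (`exp_three_le`).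
[folklore]; 0 cited facts, 0 `def`, 0 `def … : Prop`, 0 sorry.  Asserts NOTHING about an2's towers; NEVER «G-an2-4 closed» as (CONV-C); NOT D1, NOT `BetaPertH`, NOT continuum,
NOT Clay.  2026-08-22.
-/

noncomputable section

open Finset
open scoped BigOperators
open Literature.MathematicalPhysics.QuantumFieldTheory
open Literature.MathematicalPhysics.QuantumFieldTheory.Balaban1983to89
open Literature.MathematicalPhysics.QuantumFieldTheory.Balaban1983to89.Beta
open B12Sec2to5 (l1 l1_nonneg)
open ExpKernelCalculus (MKer Zl Zl_nonneg summable_exp_shift summable_exp_shift' l1_sub_triangle l1_sub_symm)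
open OneStepResolventKernel (Fib)
open LatticeForm (quo)
open Summit.QuantumFields.BalabanUV.Beta.GAN24.Push4 (vertexW vertexW_apply)
open Summit.QuantumFields.BalabanUV.Beta.GAN24.Push3 (push₃ push₃_inl_inl)
open Summit.QuantumFields.BalabanUV.Beta.GAN24.Push4TwoRate (abs_tsum_leg_le summable_leg)

namespace Summit.QuantumFields.BalabanUV.Beta.GAN24.LayerPushEntry

variable {d : ℕ}

/-! ## §0 Two bricks -/

/-- [folklore] `|Σ' f| ≤ Σ' g` whenever `|f| ≤ g` pointwise and `g` is summable. -/
theorem abs_tsum_le_tsum_of_abs_le {ι : Type*} {f g : ι → ℝ} (h : ∀ u, |f u| ≤ g u) (hg : Summable g) :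
    |∑' u, f u| ≤ ∑' u, g u := by
  have h' := tsum_of_norm_bounded hg.hasSum (fun u => by rw [Real.norm_eq_abs]; exact h u)
  rwa [Real.norm_eq_abs] at h'

/-- [folklore] **THREE FACTORS AT ONE BLOCK LABEL, POINTWISE**: with `τ := min (κ∕4) η`,
`e^{−κ‖q−U‖}·e^{−η‖q−x′‖}·e^{−η‖q−z′‖} ≤ e^{−(κ∕2)‖q−U‖}·e^{−τ(‖x′−U‖+‖z′−U‖)}` — half of the slot leg is kept for the block count, a quarter joins each of the two outer
sites through the triangle inequality (twin of leaf-03's `Push4TwoRate.exp_four_le`). -/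
theorem exp_three_le {κ η : ℝ} (hκ : 0 ≤ κ) (hη : 0 ≤ η) (q U x' z' : Fin (d + 1) → ℤ) :
    Real.exp (-κ * l1 (q - U)) * Real.exp (-η * l1 (q - x')) * Real.exp (-η * l1 (q - z'))
      ≤ Real.exp (-(κ / 2) * l1 (q - U)) * Real.exp (-(min (κ / 4) η) * (l1 (x' - U) + l1 (z' - U))) := by
  rw [← Real.exp_add, ← Real.exp_add, ← Real.exp_add, Real.exp_le_exp]
  have t2 : l1 (x' - U) ≤ l1 (x' - q) + l1 (q - U) := l1_sub_triangle _ _ _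
  have t3 : l1 (z' - U) ≤ l1 (z' - q) + l1 (q - U) := l1_sub_triangle _ _ _
  rw [l1_sub_symm x' q] at t2
  rw [l1_sub_symm z' q] at t3
  have hτ0 : 0 ≤ min (κ / 4) η := le_min (by linarith) hη
  have hτ1 : min (κ / 4) η ≤ κ / 4 := min_le_left _ _
  have hτ2 : min (κ / 4) η ≤ η := min_le_right _ _
  have a0 := l1_nonneg (q - U)
  have a2 := l1_nonneg (q - x')
  have a3 := l1_nonneg (q - z')
  have f2 := mul_le_mul_of_nonneg_left t2 hτ0
  have f3 := mul_le_mul_of_nonneg_left t3 hτ0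
  have g0 := mul_le_mul_of_nonneg_right hτ1 a0
  have g2 := mul_le_mul_of_nonneg_right hτ2 a2
  have g3 := mul_le_mul_of_nonneg_right hτ2 a3
  nlinarith [f2, f3, g0, g2, g3]

variable {l r w : Fin (d + 1) → (Fin (d + 1) → ℤ) → Fin (d + 1) → (Fin (d + 1) → ℤ) → ℝ}
  {S : Fin (d + 1) → (Fin (d + 1) → ℤ) → MKer (d + 1) (Fib d)} {ω : (Fin (d + 1) → ℤ) → ℝ} {N : ℕ} {Cl Cr Cw Cs κ m Ω : ℝ}

/-! ## §1 The vertex against the weight -/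

/-- [folklore] **THE TABLE LEG READS THE WEIGHTED SLOT PROFILE**: for a table leg with a coarse envelope `|w ν U κ u| ≤ Cw·e^{−κ‖quo N u − U‖₁}` and a weighted stencil
family `|S κ u x z a b| ≤ Cs·ω u·e^{−m(‖x−u‖₁+‖z−u‖₁)}` (`0 ≤ ω ≤ Ω`, `m > 0`), every field entry of the vertex is bounded by the `u`-series
`(d+1)·Cw·Cs · Σ'_u (e^{−κ‖quo N u − U‖₁}·ω u·e^{−m‖z−u‖₁}) · e^{−m‖x−u‖₁}` (the shape `ψ_z u · e^{−m‖x−u‖₁}` of leaf-03's `abs_tsum_leg_le`). -/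
theorem abs_vertexW_le (hw : ∀ ν U k u, |w ν U k u| ≤ Cw * Real.exp (-κ * l1 (quo N u - U)))
    (hS : ∀ k u x z a b, |S k u x z a b| ≤ Cs * ω u * Real.exp (-m * (l1 (x - u) + l1 (z - u))))
    (hω : ∀ u, 0 ≤ ω u ∧ ω u ≤ Ω) (hκ : 0 ≤ κ) (hm : 0 < m)
    (ν : Fin (d + 1)) (U x z : Fin (d + 1) → ℤ) (κ₁ κ₂ : Fin (d + 1)) :
    |vertexW w S ν U x z (Sum.inl κ₁) (Sum.inl κ₂)| ≤
      ((d : ℝ) + 1) * (Cw * Cs) * ∑' u : Fin (d + 1) → ℤ,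
        (Real.exp (-κ * l1 (quo N u - U)) * ω u * Real.exp (-m * l1 (z - u))) * Real.exp (-m * l1 (x - u)) := by
  have hCw : 0 ≤ Cw := (mul_nonneg_iff_of_pos_right (Real.exp_pos _)).mp ((abs_nonneg _).trans (hw 0 0 0 0))
  -- the majorant of one summand, and its summability (dominated by the fine decay at `x`)
  set g : (Fin (d + 1) → ℤ) → ℝ := fun u =>
    (Real.exp (-κ * l1 (quo N u - U)) * ω u * Real.exp (-m * l1 (z - u))) * Real.exp (-m * l1 (x - u)) with hg
  have hg0 : ∀ u, 0 ≤ g u := fun u => by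
    have := (hω u).1
    positivity
  have hΩ : 0 ≤ Ω := (hω 0).1.trans (hω 0).2
  have hgs : Summable g := by
    refine Summable.of_nonneg_of_le hg0 (fun u => ?_) ((summable_exp_shift hm x).mul_left Ω)
    have e1 : Real.exp (-κ * l1 (quo N u - U)) ≤ 1 := Real.exp_le_one_iff.2 (by nlinarith [l1_nonneg (quo N u - U)])
    have e2 : Real.exp (-m * l1 (z - u)) ≤ 1 := Real.exp_le_one_iff.2 (by nlinarith [l1_nonneg (z - u)])
    have h3 := (hω u).2
    have h4 := (hω u).1
    calc g u = (Real.exp (-κ * l1 (quo N u - U)) * ω u * Real.exp (-m * l1 (z - u))) * Real.exp (-m * l1 (x - u)) := rfl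
      _ ≤ (1 * Ω * 1) * Real.exp (-m * l1 (x - u)) := by
          refine mul_le_mul_of_nonneg_right ?_ (Real.exp_pos _).le
          exact mul_le_mul (mul_le_mul e1 h3 h4 zero_le_one) e2 (Real.exp_pos _).le (by positivity)
      _ = Ω * Real.exp (-m * l1 (x - u)) := by ring
  -- each `κ`-slice of the vertex
  have hslice : ∀ κ' : Fin (d + 1), |∑' u, w ν U κ' u * S κ' u x z (Sum.inl κ₁) (Sum.inl κ₂)| ≤ (Cw * Cs) * ∑' u, g u := by
    intro κ'
    have hpt : ∀ u, |w ν U κ' u * S κ' u x z (Sum.inl κ₁) (Sum.inl κ₂)| ≤ (Cw * Cs) * g u := fun u => by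
      rw [abs_mul]
      have h1 := hw ν U κ' u
      have h2 := hS κ' u x z (Sum.inl κ₁) (Sum.inl κ₂)
      have hw0 : 0 ≤ Cw * Real.exp (-κ * l1 (quo N u - U)) := by positivity
      calc |w ν U κ' u| * |S κ' u x z (Sum.inl κ₁) (Sum.inl κ₂)|
          ≤ (Cw * Real.exp (-κ * l1 (quo N u - U))) * (Cs * ω u * Real.exp (-m * (l1 (x - u) + l1 (z - u)))) :=
            mul_le_mul h1 h2 (abs_nonneg _) hw0
        _ = (Cw * Cs) * g u := by
            rw [hg, show -m * (l1 (x - u) + l1 (z - u)) = -m * l1 (z - u) + -m * l1 (x - u) by ring, Real.exp_add]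
            ring
    calc |∑' u, w ν U κ' u * S κ' u x z (Sum.inl κ₁) (Sum.inl κ₂)| ≤ ∑' u, (Cw * Cs) * g u :=
          abs_tsum_le_tsum_of_abs_le hpt (hgs.mul_left _)
      _ = (Cw * Cs) * ∑' u, g u := tsum_mul_left
  rw [vertexW_apply]
  calc |∑ κ' : Fin (d + 1), ∑' u, w ν U κ' u * S κ' u x z (Sum.inl κ₁) (Sum.inl κ₂)|
      ≤ ∑ κ' : Fin (d + 1), |∑' u, w ν U κ' u * S κ' u x z (Sum.inl κ₁) (Sum.inl κ₂)| := Finset.abs_sum_le_sum_abs _ _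
    _ ≤ ∑ _κ' : Fin (d + 1), (Cw * Cs) * ∑' u, g u := Finset.sum_le_sum fun κ' _ => hslice κ'
    _ = ((d : ℝ) + 1) * (Cw * Cs) * ∑' u, g u := by
        rw [Finset.sum_const, Finset.card_univ, Fintype.card_fin, nsmul_eq_mul]
        push_cast
        ring

/-! ## §2 The `x`-sum: the left kernel leg against the vertex -/

/-- [folklore] **THE LEFT LEG AGAINST THE VERTEX** (leaf-03's `abs_tsum_leg_le` with the weight `ψ_z u := e^{−κ‖quo N u − U‖₁}·ω u·e^{−m‖z−u‖₁}`): with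
`η₁ := min κ (m∕2)`,
`|Σ'_x Σ_{κ₁} l α x′ κ₁ x · vertexW w S ν U x z (inl κ₁) (inl κ₂)| ≤ (d+1)²·Cl·Cw·Cs·Zl_{d+1}(m∕2) · Σ'_u ψ_z u·e^{−η₁‖quo N u − x′‖₁}`. -/
theorem abs_left_le (hN : 1 ≤ N) (hl : ∀ α x' k x, |l α x' k x| ≤ Cl * Real.exp (-κ * l1 (quo N x - x')))
    (hw : ∀ ν U k u, |w ν U k u| ≤ Cw * Real.exp (-κ * l1 (quo N u - U)))
    (hS : ∀ k u x z a b, |S k u x z a b| ≤ Cs * ω u * Real.exp (-m * (l1 (x - u) + l1 (z - u))))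
    (hω : ∀ u, 0 ≤ ω u ∧ ω u ≤ Ω) (hκ : 0 < κ) (hm : 0 < m) (hCl : 0 ≤ Cl) (hCw : 0 ≤ Cw) (hCs : 0 ≤ Cs)
    (α ν : Fin (d + 1)) (x' U z : Fin (d + 1) → ℤ) (κ₂ : Fin (d + 1)) :
    |∑' x : Fin (d + 1) → ℤ, ∑ κ₁ : Fin (d + 1), l α x' κ₁ x * vertexW w S ν U x z (Sum.inl κ₁) (Sum.inl κ₂)| ≤
      (((d : ℝ) + 1) ^ 2 * (Cl * Cw * Cs)) * Zl (d + 1) (m / 2) *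
        ∑' u : Fin (d + 1) → ℤ, (Real.exp (-κ * l1 (quo N u - U)) * ω u * Real.exp (-m * l1 (z - u))) *
          Real.exp (-(min κ (m / 2)) * l1 (quo N u - x')) := by
  have hψ0 : ∀ u, 0 ≤ Real.exp (-κ * l1 (quo N u - U)) * ω u * Real.exp (-m * l1 (z - u)) := fun u => by
    have := (hω u).1; positivity
  have hΩ : 0 ≤ Ω := (hω 0).1.trans (hω 0).2
  have hψ : Summable fun u => Real.exp (-κ * l1 (quo N u - U)) * ω u * Real.exp (-m * l1 (z - u)) := by
    refine Summable.of_nonneg_of_le hψ0 (fun u => ?_) ((summable_exp_shift hm z).mul_left Ω)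
    have e1 : Real.exp (-κ * l1 (quo N u - U)) ≤ 1 := Real.exp_le_one_iff.2 (by nlinarith [l1_nonneg (quo N u - U)])
    have h3 := (hω u).2
    have h4 := (hω u).1
    calc Real.exp (-κ * l1 (quo N u - U)) * ω u * Real.exp (-m * l1 (z - u)) ≤ (1 * Ω) * Real.exp (-m * l1 (z - u)) :=
          mul_le_mul_of_nonneg_right (mul_le_mul e1 h3 h4 zero_le_one) (Real.exp_pos _).le
      _ = Ω * Real.exp (-m * l1 (z - u)) := by ring
  refine abs_tsum_leg_le (d := d) hN hκ hm (by positivity) hψ0 hψ x' (fun x => ?_)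
  -- the pointwise bound of the `x`-integrand: leg SUP × block label, times the vertex series of §1
  have hV := abs_vertexW_le hw hS hω hκ.le hm ν U x z
  calc |∑ κ₁ : Fin (d + 1), l α x' κ₁ x * vertexW w S ν U x z (Sum.inl κ₁) (Sum.inl κ₂)|
      ≤ ∑ κ₁ : Fin (d + 1), |l α x' κ₁ x * vertexW w S ν U x z (Sum.inl κ₁) (Sum.inl κ₂)| := Finset.abs_sum_le_sum_abs _ _
    _ ≤ ∑ _κ₁ : Fin (d + 1), (Cl * Real.exp (-κ * l1 (quo N x - x'))) *
          (((d : ℝ) + 1) * (Cw * Cs) * ∑' u : Fin (d + 1) → ℤ,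
            (Real.exp (-κ * l1 (quo N u - U)) * ω u * Real.exp (-m * l1 (z - u))) * Real.exp (-m * l1 (x - u))) := by
        refine Finset.sum_le_sum fun κ₁ _ => ?_
        rw [abs_mul]
        exact mul_le_mul (hl α x' κ₁ x) (hV κ₁ κ₂) (abs_nonneg _) (by positivity)
    _ = (((d : ℝ) + 1) ^ 2 * (Cl * Cw * Cs)) * Real.exp (-κ * l1 (quo N x - x')) *
          ∑' u : Fin (d + 1) → ℤ, (Real.exp (-κ * l1 (quo N u - U)) * ω u * Real.exp (-m * l1 (z - u))) * Real.exp (-m * l1 (x - u)) := by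
        rw [Finset.sum_const, Finset.card_univ, Fintype.card_fin, nsmul_eq_mul]
        push_cast
        ring

/-! ## §3 The `z`-sum and the split of the slot profile: THE WEIGHTED ENTRY ESTIMATE -/

/-- NOT IN PRINT; OUR BOOKKEEPING ([folklore] §2 twice — the right leg against the `x`-summed vertex, again by leaf-03's `abs_tsum_leg_le` — then `exp_three_le` under the `u`-series).
**THE WEIGHTED ENTRY ESTIMATE OF THE THREE-LEG PUSH** (generic `d`, relative blocking `N ≥ 1`, rates `κ, m > 0`): if the kernel legs obey the coarse envelopes
`|l α x′ κ₁ x| ≤ Cl·e^{−κ‖quo N x − x′‖₁}`, `|r β z′ κ₂ z| ≤ Cr·e^{−κ‖quo N z − z′‖₁}`, the table leg `|w ν U κ′ u| ≤ Cw·e^{−κ‖quo N u − U‖₁}` (its flatness, if any, inside `Cw`), and the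
stencil family carries the weighted slot profile `|S κ′ u x z a b| ≤ Cs·ω u·e^{−m(‖x−u‖₁+‖z−u‖₁)}` with `0 ≤ ω ≤ Ω` (any bound `Ω`; it enters no constant), then for every coarse slot `(ν, U)`, coarse sites `x′ z′` and
field indices `α β`:
`|push₃ l r w S ν U x′ z′ (inl α) (inl β)| ≤ (d+1)³·Cl·Cr·Cw·Cs·Zl_{d+1}(m∕2)² · e^{−τ(‖x′−U‖₁+‖z′−U‖₁)} · Σ'_u ω u·e^{−(κ∕2)‖quo N u − U‖₁}`, `τ := min (κ∕4) (min κ (m∕2))`.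
The last factor — the WEIGHTED BLOCK COUNT — is the only place `N` enters; every other constant is free of `N`.  (Row (LT) of QR-LL: `ω` = a boundary-layer envelope,
`Cw = K·N^{−(d+1)}` flat ⇒ `t·N^{−1}`; row (T-marg)'s mechanism: `ω ≡ 1` ⇒ `N^{d+1}·Zl`.) -/
theorem abs_push₃_inl_inl_le_weighted (hN : 1 ≤ N)
    (hl : ∀ α x' k x, |l α x' k x| ≤ Cl * Real.exp (-κ * l1 (quo N x - x')))
    (hr : ∀ β z' k z, |r β z' k z| ≤ Cr * Real.exp (-κ * l1 (quo N z - z')))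
    (hw : ∀ ν U k u, |w ν U k u| ≤ Cw * Real.exp (-κ * l1 (quo N u - U)))
    (hS : ∀ k u x z a b, |S k u x z a b| ≤ Cs * ω u * Real.exp (-m * (l1 (x - u) + l1 (z - u))))
    (hω : ∀ u, 0 ≤ ω u ∧ ω u ≤ Ω) (hκ : 0 < κ) (hm : 0 < m) (hCl : 0 ≤ Cl) (hCr : 0 ≤ Cr) (hCw : 0 ≤ Cw) (hCs : 0 ≤ Cs)
    (ν : Fin (d + 1)) (U x' z' : Fin (d + 1) → ℤ) (α β : Fin (d + 1)) :
    |push₃ l r w S ν U x' z' (Sum.inl α) (Sum.inl β)| ≤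
      (((d : ℝ) + 1) ^ 3 * (Cl * Cr * Cw * Cs) * Zl (d + 1) (m / 2) ^ 2) *
        Real.exp (-(min (κ / 4) (min κ (m / 2))) * (l1 (x' - U) + l1 (z' - U))) *
          ∑' u : Fin (d + 1) → ℤ, ω u * Real.exp (-(κ / 2) * l1 (quo N u - U)) := by
  have hη₁ : 0 ≤ min κ (m / 2) := le_min hκ.le (by linarith)
  have hZ : 0 ≤ Zl (d + 1) (m / 2) := Zl_nonneg (by linarith)
  -- the `z`-integrand's weight `ψ′ u := e^{−κ‖quo u − U‖}·ω u·e^{−η₁‖quo u − x′‖}` (free of `z`), nonnegative and summable by the slot leg alone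
  have hψ0 : ∀ u, 0 ≤ Real.exp (-κ * l1 (quo N u - U)) * ω u * Real.exp (-(min κ (m / 2)) * l1 (quo N u - x')) := fun u => by
    have := (hω u).1; positivity
  have hΩ : 0 ≤ Ω := (hω 0).1.trans (hω 0).2
  have hψ : Summable fun u => Real.exp (-κ * l1 (quo N u - U)) * ω u * Real.exp (-(min κ (m / 2)) * l1 (quo N u - x')) := by
    refine Summable.of_nonneg_of_le hψ0 (fun u => ?_) ((summable_leg (d := d) hN hκ U).mul_right Ω)
    have e2 : Real.exp (-(min κ (m / 2)) * l1 (quo N u - x')) ≤ 1 := Real.exp_le_one_iff.2 (by nlinarith [l1_nonneg (quo N u - x')])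
    have h3 := (hω u).2
    have h4 := (hω u).1
    calc Real.exp (-κ * l1 (quo N u - U)) * ω u * Real.exp (-(min κ (m / 2)) * l1 (quo N u - x'))
        ≤ Real.exp (-κ * l1 (quo N u - U)) * Ω * 1 :=
          mul_le_mul (mul_le_mul_of_nonneg_left h3 (Real.exp_pos _).le) e2 (Real.exp_pos _).le (by positivity)
      _ = Real.exp (-κ * l1 (quo N u - U)) * Ω := by ring
  -- the `z`-sum by the right leg
  rw [push₃_inl_inl]
  have hz := abs_tsum_leg_le (d := d) hN hκ hm
    (A := ((d : ℝ) + 1) * Cr * ((((d : ℝ) + 1) ^ 2 * (Cl * Cw * Cs)) * Zl (d + 1) (m / 2))) (by positivity) hψ0 hψ z'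
    (F := fun z => ∑ κ₂ : Fin (d + 1), (∑' x : Fin (d + 1) → ℤ, ∑ κ₁ : Fin (d + 1),
      l α x' κ₁ x * vertexW w S ν U x z (Sum.inl κ₁) (Sum.inl κ₂)) * r β z' κ₂ z) (fun z => ?_)
  · refine hz.trans ?_
    -- the slot profile splits three ways under the `u`-series
    have hsplit : ∀ u, (Real.exp (-κ * l1 (quo N u - U)) * ω u * Real.exp (-(min κ (m / 2)) * l1 (quo N u - x'))) *
          Real.exp (-(min κ (m / 2)) * l1 (quo N u - z'))
        ≤ (ω u * Real.exp (-(κ / 2) * l1 (quo N u - U))) * Real.exp (-(min (κ / 4) (min κ (m / 2))) * (l1 (x' - U) + l1 (z' - U))) := by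
      intro u
      have h3 := exp_three_le hκ.le hη₁ (quo N u) U x' z'
      have h4 := (hω u).1
      calc (Real.exp (-κ * l1 (quo N u - U)) * ω u * Real.exp (-(min κ (m / 2)) * l1 (quo N u - x'))) *
            Real.exp (-(min κ (m / 2)) * l1 (quo N u - z'))
          = ω u * (Real.exp (-κ * l1 (quo N u - U)) * Real.exp (-(min κ (m / 2)) * l1 (quo N u - x')) *
              Real.exp (-(min κ (m / 2)) * l1 (quo N u - z'))) := by ring
        _ ≤ ω u * (Real.exp (-(κ / 2) * l1 (quo N u - U)) * Real.exp (-(min (κ / 4) (min κ (m / 2))) * (l1 (x' - U) + l1 (z' - U)))) :=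
            mul_le_mul_of_nonneg_left h3 h4
        _ = (ω u * Real.exp (-(κ / 2) * l1 (quo N u - U))) * Real.exp (-(min (κ / 4) (min κ (m / 2))) * (l1 (x' - U) + l1 (z' - U))) := by ring
    have hL : Summable fun u => (Real.exp (-κ * l1 (quo N u - U)) * ω u * Real.exp (-(min κ (m / 2)) * l1 (quo N u - x'))) *
        Real.exp (-(min κ (m / 2)) * l1 (quo N u - z')) := by
      refine Summable.of_nonneg_of_le (fun u => mul_nonneg (hψ0 u) (Real.exp_pos _).le) (fun u => ?_) hψ
      exact mul_le_of_le_one_right (hψ0 u) (Real.exp_le_one_iff.2 (by nlinarith [l1_nonneg (quo N u - z')]))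
    have hR0 : ∀ u, 0 ≤ ω u * Real.exp (-(κ / 2) * l1 (quo N u - U)) := fun u => by have := (hω u).1; positivity
    have hR : Summable fun u => ω u * Real.exp (-(κ / 2) * l1 (quo N u - U)) := by
      refine Summable.of_nonneg_of_le hR0 (fun u => ?_) ((summable_leg (d := d) hN (by linarith : 0 < κ / 2) U).mul_left Ω)
      exact mul_le_mul_of_nonneg_right (hω u).2 (Real.exp_pos _).le
    have hsum : ∑' u, (Real.exp (-κ * l1 (quo N u - U)) * ω u * Real.exp (-(min κ (m / 2)) * l1 (quo N u - x'))) *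
          Real.exp (-(min κ (m / 2)) * l1 (quo N u - z'))
        ≤ (∑' u, ω u * Real.exp (-(κ / 2) * l1 (quo N u - U))) * Real.exp (-(min (κ / 4) (min κ (m / 2))) * (l1 (x' - U) + l1 (z' - U))) := by
      rw [← tsum_mul_right]
      exact Summable.tsum_le_tsum hsplit hL (hR.mul_right _)
    have hA : 0 ≤ ((d : ℝ) + 1) * Cr * ((((d : ℝ) + 1) ^ 2 * (Cl * Cw * Cs)) * Zl (d + 1) (m / 2)) * Zl (d + 1) (m / 2) := by positivity
    calc ((d : ℝ) + 1) * Cr * ((((d : ℝ) + 1) ^ 2 * (Cl * Cw * Cs)) * Zl (d + 1) (m / 2)) * Zl (d + 1) (m / 2) *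
          ∑' u, (Real.exp (-κ * l1 (quo N u - U)) * ω u * Real.exp (-(min κ (m / 2)) * l1 (quo N u - x'))) *
            Real.exp (-(min κ (m / 2)) * l1 (quo N u - z'))
        ≤ ((d : ℝ) + 1) * Cr * ((((d : ℝ) + 1) ^ 2 * (Cl * Cw * Cs)) * Zl (d + 1) (m / 2)) * Zl (d + 1) (m / 2) *
          ((∑' u, ω u * Real.exp (-(κ / 2) * l1 (quo N u - U))) * Real.exp (-(min (κ / 4) (min κ (m / 2))) * (l1 (x' - U) + l1 (z' - U)))) :=
          mul_le_mul_of_nonneg_left hsum hA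
      _ = (((d : ℝ) + 1) ^ 3 * (Cl * Cr * Cw * Cs) * Zl (d + 1) (m / 2) ^ 2) *
          Real.exp (-(min (κ / 4) (min κ (m / 2))) * (l1 (x' - U) + l1 (z' - U))) *
            ∑' u : Fin (d + 1) → ℤ, ω u * Real.exp (-(κ / 2) * l1 (quo N u - U)) := by ring
  · -- the pointwise bound of the `z`-integrand: §2 for each `κ₂`, the right leg's SUP and block label
    have hx := fun κ₂ => abs_left_le hN hl hw hS hω hκ hm hCl hCw hCs α ν x' U z κ₂
    -- rewrite §2's series in the `ψ′ u · e^{−m‖z−u‖}` shape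
    have hre : ∀ κ₂ : Fin (d + 1), |∑' x : Fin (d + 1) → ℤ, ∑ κ₁ : Fin (d + 1), l α x' κ₁ x * vertexW w S ν U x z (Sum.inl κ₁) (Sum.inl κ₂)| ≤
        (((d : ℝ) + 1) ^ 2 * (Cl * Cw * Cs)) * Zl (d + 1) (m / 2) *
          ∑' u : Fin (d + 1) → ℤ, (Real.exp (-κ * l1 (quo N u - U)) * ω u * Real.exp (-(min κ (m / 2)) * l1 (quo N u - x'))) *
            Real.exp (-m * l1 (z - u)) := by
      intro κ₂
      refine (hx κ₂).trans (le_of_eq ?_)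
      congr 1
      exact tsum_congr fun u => by ring
    calc |∑ κ₂ : Fin (d + 1), (∑' x : Fin (d + 1) → ℤ, ∑ κ₁ : Fin (d + 1), l α x' κ₁ x * vertexW w S ν U x z (Sum.inl κ₁) (Sum.inl κ₂)) * r β z' κ₂ z|
        ≤ ∑ κ₂ : Fin (d + 1), |(∑' x : Fin (d + 1) → ℤ, ∑ κ₁ : Fin (d + 1), l α x' κ₁ x * vertexW w S ν U x z (Sum.inl κ₁) (Sum.inl κ₂)) * r β z' κ₂ z| :=
          Finset.abs_sum_le_sum_abs _ _
      _ ≤ ∑ _κ₂ : Fin (d + 1), ((((d : ℝ) + 1) ^ 2 * (Cl * Cw * Cs)) * Zl (d + 1) (m / 2) *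
          ∑' u : Fin (d + 1) → ℤ, (Real.exp (-κ * l1 (quo N u - U)) * ω u * Real.exp (-(min κ (m / 2)) * l1 (quo N u - x'))) *
            Real.exp (-m * l1 (z - u))) * (Cr * Real.exp (-κ * l1 (quo N z - z'))) := by
          refine Finset.sum_le_sum fun κ₂ _ => ?_
          rw [abs_mul]
          refine mul_le_mul (hre κ₂) (hr β z' κ₂ z) (abs_nonneg _) (mul_nonneg (by positivity) (tsum_nonneg fun u => ?_))
          have := (hω u).1
          positivity
      _ = ((d : ℝ) + 1) * Cr * ((((d : ℝ) + 1) ^ 2 * (Cl * Cw * Cs)) * Zl (d + 1) (m / 2)) * Real.exp (-κ * l1 (quo N z - z')) *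
          ∑' u : Fin (d + 1) → ℤ, (Real.exp (-κ * l1 (quo N u - U)) * ω u * Real.exp (-(min κ (m / 2)) * l1 (quo N u - x'))) *
            Real.exp (-m * l1 (z - u)) := by
          rw [Finset.sum_const, Finset.card_univ, Fintype.card_fin, nsmul_eq_mul]
          push_cast
          ring

end Summit.QuantumFields.BalabanUV.Beta.GAN24.LayerPushEntry

end
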